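import Literature.Analysis.FluidPDE.KwonMollifiedDriftCalculus
import Literature.Analysis.FluidPDE.JiaSverak2014PerturbedLocalEnergy
import HarnessLib

/-!
# The local energy inequality of `u − h_ρ` for Kwon's time-mollified drift ((⋆_ρ))

Analysis/FluidPDE proof file (theorems only) on the discharge path of the named fact
`Literature.Analysis.FluidPDE.kwon2023_velocity_epsilon_regularity`
(`PressureFreeEpsilonRegularity.lean`; H. Kwon, J. Differential Equations (2023) =
arXiv:2104.03160, Thm. 1.4). Step (S1) of the local energy clause of Lemma 2.5 (Def. 2.4 for the
decomposition `u = v + h` of Remark 2.3): the tree's forced-remainder local energy inequality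
(`JiaSverak2014.forced_remainder_local_energy_inequality_localDiv`, Jia–Šverák 2014 / Lemarié-
Rieusset 2016 Thm. 14.7, in the form asking `div e = 0` only ON `Ω`) applied to the smooth field
`e = h_ρ = ρ ⋆_t driftField W` (jointly `C^∞`, `KwonMollifiedDriftSmooth`; divergence free on
`B₁`, `KwonMollifiedDriftCalculus`) with the forcing `g = ∂ₜh_ρ − νΔh_ρ`:

* `Kwon2023.mollifiedDrift_remainder_local_energy_inequality` — for `(u, p)` distributional
  Navier–Stokes on an open `Ω ⊆ ℝ × B₁` with the CKN data (weak gradient `G ∈ L²_loc`, local energy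
  inequality, `u ∈ L³_loc`, `p ∈ L^{3/2}_loc`) and every `φ ∈ C_c^∞(Ω)`, `φ ≥ 0`:
  `2ν ∫∫ |G − Dh_ρ|² φ ≤ ∫∫ |u − h_ρ|²(φₜ + νΔφ) + ∫∫ (|u − h_ρ|² − |h_ρ|²) u·∇φ + 2∫∫ p (u − h_ρ)·∇φ
   − 2∫∫ φ ⟪Dh_ρ(u), u⟫ − 2∫∫ φ ⟪u − h_ρ, ∂ₜh_ρ − νΔh_ρ⟫`.

The remaining steps of the clause (memo `kits/A4-needsX-lit-a4.md` §0'' v3: express `∂ₜh_ρ` by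
`hasDerivAt_inner_timeConv_driftField`, let `ρ → δ₀`, convert to Kwon's fields) start from here.
No NS-regularity statement is touched.

## Mathlib / tree search

Tree (reused): `JiaSverak2014.forced_remainder_local_energy_inequality_localDiv`
(`JiaSverak2014PerturbedLocalEnergy`); `contDiff_timeConv_driftField` (`KwonMollifiedDriftSmooth`);
`divergence_timeConv_driftField_eq_zero` (`KwonMollifiedDriftCalculus`);
`IsSmoothSpaceTimeOn.of_contDiff_univ/continuous_of_univ/timeDerivWithin/laplacian/
hasDerivWithinAt_timeDerivWithin` (`ClassicalSolutionCalculus`, `CaloricRemainderCalculus`);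
`timeDerivWithin_of_mem_interior` (`WeakSolution`).

## References

* H. Kwon, *The role of the pressure in the regularity theory for the Navier–Stokes equations*,
  J. Differential Equations 357 (2023) = arXiv:2104.03160: Def. 2.4, Remark 2.3 and Lemma 2.5
  (proof, p. 8–9). [Kwon2023RolePressure]
* H. Jia, V. Šverák, Invent. Math. 196 (2014), §3 proof of Thm. 3.1. [JiaSverak2014]
-/

noncomputable section

open MeasureTheory Set Function Filter Topology TopologicalSpace Metric InnerProductSpace
  ContinuousLinearMap
open scoped NNReal ENNReal RealInnerProductSpace Convolution ContDiff Laplacian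

namespace Literature.Analysis.FluidPDE

namespace Kwon2023

variable {u W : ℝ → EuclideanSpace ℝ (Fin 3) → EuclideanSpace ℝ (Fin 3)} {p : ℝ → EuclideanSpace ℝ (Fin 3) → ℝ}
  {G : ℝ → EuclideanSpace ℝ (Fin 3) → EuclideanSpace ℝ (Fin 3) →L[ℝ] EuclideanSpace ℝ (Fin 3)}
  {Ω : Opens (ℝ × EuclideanSpace ℝ (Fin 3))} {ν : ℝ} {θ : ℝ → EuclideanSpace ℝ (Fin 3) → ℝ}

/-- **The local energy inequality of `u − h_ρ`** ((⋆_ρ) of the local energy step of Kwon's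
Lemma 2.5): the forced-remainder local energy inequality of Jia–Šverák / Lemarié-Rieusset for the
smooth, on-`Ω`-divergence-free field `e = h_ρ = ρ ⋆_t (driftField W)` with forcing
`g = ∂ₜh_ρ − νΔh_ρ`, for a distributional Navier–Stokes solution `(u, p)` with the CKN data on an
open `Ω ⊆ ℝ × B₁` and `φ ∈ C_c^∞(Ω)`, `φ ≥ 0`.
[cite: Kwon2023RolePressure, Lemma 2.5 (proof, p. 8–9) with Def. 2.4 and Remark 2.3] -/
theorem mollifiedDrift_remainder_local_energy_inequality (hW : IsGoodVelocity W)
    (hΩ : ∀ z ∈ (Ω : Set (ℝ × EuclideanSpace ℝ (Fin 3))), ‖z.2‖ < 1)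
    (hNS : IsDistributionalNSSolutionOn Ω ν 0 u p)
    (hG : HasWeakSpatialGradientOn Ω u G)
    (hG2 : ∀ K ⊆ (Ω : Set (ℝ × EuclideanSpace ℝ (Fin 3))), IsCompact K →
      ∫⁻ z in K, ENNReal.ofReal (frobeniusNormSq (G z.1 z.2)) < ⊤)
    (hLEI : ∀ φ : ℝ → EuclideanSpace ℝ (Fin 3) → ℝ, IsSpaceTimeTestOn Ω φ → (∀ t x, 0 ≤ φ t x) →
      2 * ν * ∫ t, ∫ x, frobeniusNormSq (G t x) * φ t x ≤
        ∫ t, ∫ x, (‖u t x‖ ^ 2 * (timeDeriv φ t x + ν * Δ (φ t) x) +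
          (‖u t x‖ ^ 2 + 2 * p t x) * ⟪u t x, gradient (φ t) x⟫ +
          2 * ⟪(0 : ℝ → EuclideanSpace ℝ (Fin 3) → EuclideanSpace ℝ (Fin 3)) t x, u t x⟫ * φ t x))
    (hu3 : ∀ K ⊆ (Ω : Set (ℝ × EuclideanSpace ℝ (Fin 3))), IsCompact K →
      MemLp (uncurry u) 3 (volume.restrict K))
    (hp32 : ∀ K ⊆ (Ω : Set (ℝ × EuclideanSpace ℝ (Fin 3))), IsCompact K →
      MemLp (uncurry p) (3 / 2) (volume.restrict K))
    (φ : ContDiffBump (0 : ℝ)) (hθ : IsSpaceTimeTestOn Ω θ) (hθ0 : ∀ t x, 0 ≤ θ t x) :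
    2 * ν * ∫ t, ∫ x, frobeniusNormSq (G t x -
        fderiv ℝ (fun y => (φ.normed volume ⋆[lsmul ℝ ℝ, volume] fun σ => driftField W σ y) t) x) * θ t x ≤
      (∫ t, ∫ x, ‖u t x - (φ.normed volume ⋆[lsmul ℝ ℝ, volume] fun σ => driftField W σ x) t‖ ^ 2 *
          (timeDeriv θ t x + ν * Δ (θ t) x)) +
        (∫ t, ∫ x, (‖u t x - (φ.normed volume ⋆[lsmul ℝ ℝ, volume] fun σ => driftField W σ x) t‖ ^ 2 -
            ‖(φ.normed volume ⋆[lsmul ℝ ℝ, volume] fun σ => driftField W σ x) t‖ ^ 2) *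
          ⟪u t x, gradient (θ t) x⟫) +
        2 * (∫ t, ∫ x, p t x *
          ⟪u t x - (φ.normed volume ⋆[lsmul ℝ ℝ, volume] fun σ => driftField W σ x) t, gradient (θ t) x⟫) -
        2 * (∫ t, ∫ x, θ t x *
          ⟪fderiv ℝ (fun y => (φ.normed volume ⋆[lsmul ℝ ℝ, volume] fun σ => driftField W σ y) t) x (u t x),
            u t x⟫) -
        2 * ∫ t, ∫ x, θ t x *
          ⟪u t x - (φ.normed volume ⋆[lsmul ℝ ℝ, volume] fun σ => driftField W σ x) t,
            timeDeriv (fun s y => (φ.normed volume ⋆[lsmul ℝ ℝ, volume] fun σ => driftField W σ y) s) t x -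
              ν • Δ (fun y => (φ.normed volume ⋆[lsmul ℝ ℝ, volume] fun σ => driftField W σ y) t) x⟫ := by
  set e : ℝ → EuclideanSpace ℝ (Fin 3) → EuclideanSpace ℝ (Fin 3) := fun t x =>
    (φ.normed volume ⋆[lsmul ℝ ℝ, volume] fun σ => driftField W σ x) t with he_def
  have he : ContDiff ℝ (⊤ : ℕ∞) (uncurry e) := contDiff_timeConv_driftField hW φ
  have hes : IsSmoothSpaceTimeOn univ e := IsSmoothSpaceTimeOn.of_contDiff_univ he
  -- the forcing `g = ∂ₜe − νΔe`
  set g : ℝ → EuclideanSpace ℝ (Fin 3) → EuclideanSpace ℝ (Fin 3) := fun t x =>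
    timeDeriv e t x - ν • Δ (e t) x with hg_def
  have htd : ∀ t x, timeDerivWithin univ e t x = timeDeriv e t x := fun t x =>
    timeDerivWithin_of_mem_interior (by rw [interior_univ]; exact mem_univ _) x
  have hg : Continuous (uncurry g) := by
    have h1 : Continuous fun z : ℝ × EuclideanSpace ℝ (Fin 3) => timeDerivWithin univ e z.1 z.2 :=
      (hes.timeDerivWithin uniqueDiffOn_univ).continuous_of_univ
    have h1' : Continuous fun z : ℝ × EuclideanSpace ℝ (Fin 3) => timeDeriv e z.1 z.2 := by
      refine h1.congr fun z => ?_
      exact htd z.1 z.2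
    have h2 : Continuous fun z : ℝ × EuclideanSpace ℝ (Fin 3) => Δ (e z.1) z.2 :=
      (hes.laplacian uniqueDiffOn_univ).continuous_of_univ
    exact h1'.sub (h2.const_smul ν)
  have hheat : ∀ z ∈ (Ω : Set (ℝ × EuclideanSpace ℝ (Fin 3))),
      HasDerivAt (fun s => e s z.2) (ν • (Δ (e z.1)) z.2 + g z.1 z.2) z.1 := by
    intro z _
    have h := (hes.hasDerivWithinAt_timeDerivWithin uniqueDiffOn_univ (mem_univ z.1) z.2).hasDerivAt
      univ_mem
    rw [htd] at h
    refine h.congr_deriv ?_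
    simp only [hg_def]
    abel
  have hdiv : ∀ z ∈ (Ω : Set (ℝ × EuclideanSpace ℝ (Fin 3))), VectorCalculus.divergence (e z.1) z.2 = 0 :=
    fun z hz => divergence_timeConv_driftField_eq_zero hW φ z.1 (hΩ z hz)
  exact JiaSverak2014.forced_remainder_local_energy_inequality_localDiv hNS hG hG2 hLEI hu3 hp32 he hg
    hheat hdiv hθ hθ0

end Kwon2023

end Literature.Analysis.FluidPDE

end
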